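import Literature.MathematicalPhysics.QuantumFieldTheory.Balaban1983to89.B6Prop26ReachTransplantL0
import Literature.MathematicalPhysics.QuantumFieldTheory.Balaban1983to89.B6SectADomainsV1
import Literature.MathematicalPhysics.QuantumFieldTheory.Balaban1983to89.B6Prop26ChainGeneric
import Literature.MathematicalPhysics.QuantumFieldTheory.Balaban1983to89.B6Eq291Generator
import Literature.MathematicalPhysics.QuantumFieldTheory.Balaban1983to89.B6Geom246MultiLevelBoxL0
import Literature.MathematicalPhysics.QuantumFieldTheory.Balaban1983to89.B6Geom246MultiLevelTorusL0
import Literature.MathematicalPhysics.QuantumFieldTheory.Balaban1983to89.B6MultiLevelBoxOperatorL0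
import Literature.MathematicalPhysics.QuantumFieldTheory.Balaban1983to89.B6MultiLevelTorusOperatorL0
import Literature.MathematicalPhysics.QuantumFieldTheory.Balaban1983to89.B6GlobalChartV1

/-!
# `Balaban1983to89.B6GlobalChartV1L0` — LEVEL-0 TWIN (programme G-F3′-L0, director-ym LINE №27 / UV3-NODE §24.5; plan `lit-balaban-r03/G-F3L0-PLAN.md`) of `B6GlobalChartV1`:
the same declarations, SAME NAMES AND STATEMENTS, for nested families WITH print's region `Λ₀ = T ∖ Ω₁` ADMITTED (structures
`B6MultiLevelBoxOperatorL0.Domains` / `B6MultiLevelTorusOperatorL0.TDomains`: levels `0, …, k`, the level-`0` block a single site, `Q′₀ = id`,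
finite weight `a₀` — print p.225 (2.14) «Σ_{j=0}^k … (Q′₀λ)(x) = λ(x), x ∈ Λ₀», p.229 «taking a sequence (2.1) … smallest possible domains B^j(Λ_j),
and considering the operator Δ_a defined by (2.19), (2.20) for this sequence»).  Every `D`-free object is the lineage's, consumed BY NAME; no existing
module is touched; no fact is minted.  Unit `lit-balaban-r03` (B6 fold owner, r03 gen 36); referee ref-4.  THE TWIN'S DOCUMENTATION FOLLOWS
VERBATIM (its «levels 1 … k» / «Ω₁ = X» sentences describe the twin; here `j` runs from `0` and `Ω₁` may be a proper subset).

# `Balaban1983to89.B6GlobalChartV1` — T. Bałaban, *Propagators and renormalization transformations for lattice gauge theories. II*, Commun. Math.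
# Phys. **96** (1984) 223–250 [Balaban1984PropagatorsII]: THE GLOBAL IDENTITY CHART between the V1 torus `T_η = Site P 0` (the carrier of the
# multi-level `Δ_a`, `G = Δ_a⁻¹` of (2.19)/(2.22), `B6SectAVectorModelV1`) and p21's fundamental box `Π_μ[0, N_μ)` (the carrier of the block geometry
# `𝔅`, the distance (2.46), Lemma 2.1 and the torus family `TDomains`/`geomT`): blocks ↦ blocks at every level, p21's torus family read as a V1
# `Domains` (so that `Δ_a` is defined on a family satisfying (2.2)), and (2.133) ⟹ the `h2133` local majorant of Proposition 2.6's gluing FOR THE V1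
# GLOBAL LATTICE (ROUTE V of the B6 fold owner's design note, B6-CLOSURE.md §5 item 7; no existing module is touched; no fact is minted)

statement-level skeleton of published theorems with citation tags; proofs where landed; nothing here is a claim about the Yang–Mills mass gap

PDF held: `paper:balaban1984-cmp96-propagators-rt-ii` (journal page = PDF page + 222); p. 224 [PDF 2] ((2.1)–(2.4)), p. 231 [PDF 9] ((2.45)–(2.46)),
pp. 238–239 [PDF 16–17] (T_□, (2.90)–(2.91)), p. 247 [PDF 25] ((2.133), Prop. 2.6) re-read as page renders this generation.  Unit `lit-balaban-r03` (B6
fold owner; r03 gen 18, literature-prover-lit-balaban-r03-g18-0), HOME `run/shared/lean/pub/lit-balaban/`; referee ref-4.  SKELETON rows **B6.Eq2.1** ×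
**B6.Eq2.133** × **B6.Prop2.6** (cells; decls of record untouched).  Sibling consumed BY NAME: `B6Prop26ReachTransplant` (r03 gen 18, p342390/p342928:
`transplant`, `chartBond`, `InWindow`, `reach2133_G`/`_DG`, `hglob_sites`, `hfib_sites`).

## WHAT IS PRINTED (verbatim up to notation)

p. 224: *"We consider a sequence of domains Ω₁ ⊃ Ω₂ ⊃ … ⊃ Ω_k, Ω_j ⊂ T_η, j = 1, 2, …, k, (2.1) which satisfy the following conditions:
Ω_j = B^j(Ω_j^{(j)}), Ω_j^{(j)} ⊂ T^{(j)}_{L^jη} and it is a sum of big blocks, (L^jη)^{−1}dist(Ω_j^c, Ω_{j+1}) > RM … (2.2) … Let us notice that we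
admit the case when some domains Ω_j are equal to T_η"*.  p. 231: *"d(x, x′) = d(y, y′) if x ∈ B^j(y), x′ ∈ B^{j′}(y′)."*  p. 239: *"We form an
approximation of G taking as usual G₀ = Σ_{□∈𝒟} h_□G_□h_□."*  p. 247: (2.133) and *"Reasoning in the same way as in the proof of Proposition 2.2 we
obtain Proposition 2.6."*

WHY THIS FILE (B6-CLOSURE §5 item 7, the (d) design note of r03 gen 18): the genuine multi-level `Δ_a`/`G` exist ONLY on the V1 torus carriers
(`B6SectAVectorModelV1.deltaAE`/`GE` over `B6SectADomainsV1.Domains`, which records (2.1) but not (2.2)), while `𝔅`, (2.46), Lemma 2.1, the cover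
and (2.88) exist ONLY on p21's integer carriers (`TDomains`, `geomT`, …).  ROUTE V of the note glues Prop. 2.6 on the V1 global lattice with p21's
geometry read through the identity chart `x ↦ (val x_μ)_μ`; this file is its item (d1).

## WHAT THIS FILE CERTIFIES (kernel-checked, sorry-free, standard axioms)

* §1 `PV d ℓ m K` (the V1 parameter record of a global torus of dimension `d+1`, `L = ℓ+1`), **`toBox hN : Site (PV …) 0 → ↥(boxDom (N0 ℓ Mh k P′))`**
  (the identity chart, under `hN : N0 ℓ Mh k P′ ≡ 2L^{m+K}` = «the fundamental box IS the torus»), `toBox_injective`, `toBox_surjective`, **`blk_toBox`**: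
  `blk (L^j) (toBox x) = rep (iterBlockOf j x)` — BLOCKS ↦ BLOCKS AT EVERY LEVEL `j ≤ m+K` (both lineages label blocks by `⌊x_μ/L^j⌋`).
* §2 `blkV1 hN D b := blkOf D.toDomains (toBox b.src)` (the global block map `y(b₋)` of the V1 bonds in p21's `𝔅`), `GlV1 t hN W x₀ := transplant W
  (chartBond t (labels of b₋) dir x₀) (onFun G_□)` (the two-scale member `t` read on the V1 global bond functions), and **`reach2133_G_V1`** /
  `reach2133_DG_V1`: ONE `δ₂ > 0`, `A ≥ 0` (on `d, L, a₀, a₁`) such that for every member, every global torus, every `D : TDomains` with `hN`, every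
  two-level window of the fundamental box (corner `∈ L^jℤ^{d+1}`, side `≤ L^{m_t+K_t}`), every finite set of window bonds and every reach `S ⊂ 𝔅`:
  `LocalMajorant (g := geomT D) (blkV1 hN D) (GlV1 t hN W x₀) S (L^{d+1}·A·e^{2δ₂}·e^{−(δ₂/(d+1))·d_T})` — the hypothesis `h2133` of
  `B6Prop26Gluing.prop26_2136_of_2133_2134(_lemma21)` / `B6Prop26ChainGeneric.prop26_2136_of_2133_2134With` ON THE LATTICE OF `deltaAE`/`GE`
  (inputs: `reach2133_G`, `hglob_sites` + `distT_le_dist_box`, `hfib_sites` of the sibling).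
* §3 **`domT hN D hk : B6SectADomainsV1.Domains (PV …)`** — p21's torus family READ AS THE V1 DOMAIN DATUM (`Ω₀ := T_η`, `Ω_j^{(j)} := {y : every fine
  site of B^j(y) has level ≥ j}` for `1 ≤ j ≤ k`, `∅` above `k`; `nested` from `iterBlockOf_succ`), **`iterBlockOf_mem_domT_iff`**: for `1 ≤ j ≤ k`,
  `iterBlockOf j x ∈ Ω_j^{(j)} ↔ j ≤ D.lev (toBox x)` (by (2.1): membership is constant on big `j`-blocks, `B6MultiLevelTorusOperator.TDomains.bigBlocks`, via
  `blk_bigSide_eq_of_blk_eq`; `Ω₁ = T_η`: `domT_Om_one`).  Hence `B6SectAVectorModelV1.deltaAE` over `domT hN D hk` IS the multi-level `Δ_a` of a family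
  satisfying (2.1) AND (2.2), with `𝔅`, (2.46), Lemma 2.1 (`lemma21_torus`) and the `h2133` input available on the same lattice.
* §4 **`prop26_2136_V1_of_2134_291`** — ROUTE V ASSEMBLED UP TO THE OPERATOR INPUTS: `B6Prop26ChainGeneric.prop26_2136_of_2133_2134With` on
  `X := PBond (PV …) 0`, `g := geomT D`, `blk := blkV1 hN D`, `Gl □ := GlV1 (t □) hN (W □) (x₀ □)`, `P ≡ 1`, with (2.133) DISCHARGED by `reach2133_G_V1`
  and Lemma 2.1 ((2.61)/(2.63) at rate `δ₂′/2`, split `α`, constant `c₁ = K261 N₀ (d+1) L 1 (α·δ₂′/2)`) + (2.54) DISCHARGED by p21's `lemma21_torus` /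
  `triangle_refl_nonneg_T`: for every cube family with overlap `≤ N`, cut-offs `|h_□| ≤ 1` supported in `S_□`, GIVEN (2.134) for the genuine kernels
  (`θ₀e^{−(δ₂′/2)d_T}`, `hKout`), (2.91) (`Δ_aG₀ = 1 − R`), `GΔ_a = 1` and `N²θ₀c₁ < 1`, the conclusion
  `HasMajorant (blkV1 hN D) G ((N·A′)·c₁·(1 − N²θ₀c₁)⁻¹·e^{−(1−α)(δ₂′/2)d_T})` = (2.136)₁.  The remaining hypotheses are EXACTLY items (d3) ((2.91) for
  `deltaAE` with the transplanted members) and (d4) (the genuine (2.134)) of the design note, plus cover data.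
* §5 (v1.1) **`prop26_2136_V1_of_2134_eq291`** — one step further: (2.91) `Δ_aG₀ = 1 − R` DISCHARGED by the ring identity `B6Eq291Generator.eq291`
  for the genuine (2.92)/(2.93) family `K_{□,□′} := kFam (∂P∂*) h ζ M P` and `|h_□| ≤ 1` by (2.36) (`abs_le_one_of_sum_sq`); the hypotheses left are
  the five RING DATA of (2.91) in V1 vocabulary — `Σ_□ h_□² = 1`, `ζ_□h_□ = h_□ = h_□ζ_□`, `Δ_a = M − ∂P∂*`, AGREEMENT `M·h_□ = M_□·h_□` of the local part
  with the member's local operator, INVERSION `(M_□ − P_□)·G_□·h_□ = h_□` by the transplanted member — plus (2.134)/`hKout` for that family, `GΔ_a = 1`,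
  `N²θ₀c₁ < 1`: the literal typed targets of (d3) (agreement/inversion for `deltaAE` vs. transplanted `tsV1`) and (d4).

## HONEST SCOPE / DIVERGENCES

(1) The V1 torus is cubic with `2L^{m+K}` sites per direction; `hN` forces p21's parameters to satisfy `L^k·L·M_h·P′_μ = 2L^{m+K}`, i.e. the big-block
size `M = L·M_h` is a power of `L` (or twice one) — an honest restriction of ROUTE V («Ω_j is a sum of big blocks» must tile the torus); `k ≤ m + K` is
the hypothesis `hk`.  (2) `domT` has no `Λ₀` (`Ω₀ = Ω₁ = T_η`): p21's reading (levels `1 … k`); print admits it («some domains Ω_j are equal to T_η»).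
(3) Windows are sub-cubes of the fundamental box (no wrap-around; wrapping cubes go through `B6MultiLevelTorusOperatorL0.TDomains.chart`/`distT_le_dist_chart`, not done here).
(4) Nothing here touches the OPERATORS: the identification of V1's `R = RE` (orthogonal projection onto `ΔN(Q′)`) with p21's `P`/`pM` under the chart,
the torus (2.87)/(2.88), the identity (2.91) for `deltaAE` with the transplanted `G_□`'s and the genuine (2.134) are items (d2)–(d4) of the design note
and enter §4 as HYPOTHESES (`h291`, `hR`, `hG0`, `hinv`, `h2134`, `hKout`, `hsmall`; §5: the ring data of (2.91) instead of `h291`/`hR`/`hG0`) — §4/§5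
are the typed statements of what (d3)/(d4) must deliver, not their discharge.  No `def … : Prop`, no new hypothesis-shaped fact; value = typed skeleton (a dictionary) + one assembled implication, NOT summit progress.
-/

noncomputable section

open scoped BigOperators
open Finset

namespace Literature.MathematicalPhysics.QuantumFieldTheory.Balaban1983to89.B6GlobalChartV1L0

open B4Reflection242 (boxDom mem_boxDom blk)
open B4ContourShift (supNorm)
open B5Eq118OneStroke (iterBlockOf val_iterBlockOf)
open B6LowerBound2153Torus (rep)
open B5Eq117TorusCarriers (Mk)
open B6MultiLevelBoxOperator (N0)
open B6MultiLevelBoxOperatorL0 (Domains)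
open B6MultiLevelTorusOperatorL0 (TDomains)
open B6Geom246MultiLevelBoxL0 (bset blkOf geom bond)
open B6Geom246MultiLevelTorusL0 (geomT bondT distT_le_dist_box)
open B6RandomWalk (HasMajorant)
open B6Prop26Gluing (LocalMajorant)
open B6Prop25TwoScaleCensus (TSIdx)
open B6Ineq2133TwoScaleV1 (onFun)
open B6Prop26ReachTransplant (transplant chartBond InWindow reach2133_G reach2133_DG)
open B6Prop26ReachTransplantL0 (hglob_sites hfib_sites)
open Literature.MathematicalPhysics.QuantumFieldTheory.Balaban1983to89.B6GlobalChartV1 (PV toBox toBox_apply toBox_injective toBox_surjective boxEquiv boxEquiv_apply val_boxEquiv_symm blk_toBox GlV1 blk_bigSide_eq_of_blk_eq)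

variable {d ℓ : ℕ}

/-! ## §1  The V1 global torus `T_η = Site P 0` and p21's fundamental box `Π_μ [0, N_μ)`: the identity chart -/

section Chart

variable {m K : ℕ} {hd : 1 ≤ d + 1} {hL : Odd (ℓ + 1) ∧ 1 < ℓ + 1}

end Chart

/-! ## §2  (2.133) ⟹ `h2133` FOR THE V1 GLOBAL TORUS with p21's torus geometry `geomT D` read through the chart -/

section H2133

variable {m K : ℕ} {hd : 1 ≤ d + 1} {hL : Odd (ℓ + 1) ∧ 1 < ℓ + 1} {a₀ a₁ : ℝ}

/-- **THE GLOBAL BLOCK MAP OF THE V1 TORUS**: the bond `b = ⟨x, μ⟩` of `T_η` is sent to the block of p21's torus family `D` containing the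
chart point of `x` — `y(b₋) ∈ 𝔅` (p. 231 *"d(x, x′) = d(y, y′) if x ∈ B^j(y)"*). [cite: Balaban1984PropagatorsII, (2.45)–(2.46) p.231, dictionary] -/
def blkV1 {Mh k R : ℕ} {P' : Fin (d + 1) → ℕ} (hN : ∀ μ, N0 ℓ Mh k P' μ = (PV d ℓ m K hd hL).sitesPerDir 0) (D : TDomains d ℓ Mh k P' R)
    (b : PBond (PV d ℓ m K hd hL) 0) : ↥(bset D.toDomains) :=
  blkOf D.toDomains (toBox hN b.src)

/-- `(labels of b₋, direction)` determines the bond. [cite: Balaban1984PropagatorsII, p.224 («Ω also the set of bonds»), dictionary] -/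
private theorem injOn_pos_dir_V1 {Mh k : ℕ} {P' : Fin (d + 1) → ℕ} (hN : ∀ μ, N0 ℓ Mh k P' μ = (PV d ℓ m K hd hL).sitesPerDir 0)
    (W : Finset (PBond (PV d ℓ m K hd hL) 0)) :
    Set.InjOn (fun b : PBond (PV d ℓ m K hd hL) 0 => ((toBox hN b.src : Fin (d + 1) → ℤ), b.dir)) ↑W := by
  intro b _ b' _ h
  simp only [Prod.mk.injEq] at h
  obtain ⟨h1, h2⟩ := h
  have hsrc : b.src = b'.src := toBox_injective hN (Subtype.ext h1)
  cases b
  cases b'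
  simp only at hsrc h2
  subst hsrc
  subst h2
  rfl

/-- **(2.133) ⟹ `h2133` ON THE V1 GLOBAL TORUS `T_η` WITH p21's TORUS GEOMETRY** (ROUTE V of B6-CLOSURE §5 item 7): ONE `δ₂ > 0`, ONE `A ≥ 0` (on
`d, L, a₀, a₁`) such that for every two-scale member `G_□` (`t`), every V1 global torus (`m, K`), every torus family `D : TDomains` whose fundamental box
IS the torus (`hN`; `M_h ≥ 1`, `P′_μ ≥ 1`), every two-level window of the fundamental box (corner `x₀ ∈ L^jℤ^{d+1}`, side `≤ L^{m_t+K_t}` of the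
member, levels `j`, `j+1`), every finite set `W` of window bonds and every reach `S ⊂ 𝔅`:
`LocalMajorant (g := geomT D) (blkV1 hN D) (GlV1 t hN W x₀) S (L^{d+1}·A·e^{2δ₂}·e^{−(δ₂/(d+1))·d_T(y,y′)})` — the hypothesis `h2133` of
`B6Prop26Gluing.prop26_2136_of_2133_2134(_lemma21 / B6Prop26ChainGeneric.…With)` for the lattice of `deltaAE`/`GE`.
[cite: Balaban1984PropagatorsII, (2.133) p.247, (2.90)–(2.91) p.239, Prop. 2.6 p.247] -/
theorem reach2133_G_V1 (d ℓ : ℕ) (hd : 1 ≤ d + 1) (hL : Odd (ℓ + 1) ∧ 1 < ℓ + 1) {a₀ a₁ : ℝ} (ha₀ : 0 < a₀) (ha₁ : a₀ ≤ a₁) :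
    ∃ δ : ℝ, 0 < δ ∧ ∃ A : ℝ, 0 ≤ A ∧ ∀ (t : TSIdx d (ℓ + 1) hd hL a₀ a₁) (m K : ℕ) {Mh k R : ℕ} {P' : Fin (d + 1) → ℕ}
      (hN : ∀ μ, N0 ℓ Mh k P' μ = (PV d ℓ m K hd hL).sitesPerDir 0) (D : B6MultiLevelTorusOperatorL0.TDomains d ℓ Mh k P' R) (_ : 1 ≤ Mh) (_ : ∀ μ, 1 ≤ P' μ)
      (x₀ : Fin (d + 1) → ℤ) (_ : ∀ μ, (((ℓ + 1) ^ t.j : ℕ) : ℤ) ∣ x₀ μ) (Wd : ℕ) (_ : Wd ≤ (ℓ + 1) ^ (t.m + t.K))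
      (_ : ∀ z ∈ boxDom (N0 ℓ Mh k P'), (∀ μ, x₀ μ ≤ z μ ∧ z μ < x₀ μ + Wd) → t.j ≤ D.lev z ∧ D.lev z ≤ t.j + 1)
      (W : Finset (PBond (PV d ℓ m K hd hL) 0))
      (_ : ∀ b ∈ W, InWindow (fun b : PBond (PV d ℓ m K hd hL) 0 => (toBox hN b.src : Fin (d + 1) → ℤ)) x₀ Wd b)
      (S : Set (geomT D).Site),
      LocalMajorant (g := geomT D) (blkV1 hN D) (GlV1 t hN W x₀) S
        (fun a b => ((ℓ + 1) ^ (d + 1) : ℕ) * ((A * Real.exp (δ * ((d + 1 : ℝ) + (d + 1)) / (d + 1))) *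
          Real.exp (-(δ / (d + 1) * (geomT D).dist a b)))) := by
  obtain ⟨δ, hδ, A, hA, h⟩ := reach2133_G d (ℓ + 1) hd hL ha₀ ha₁
  refine ⟨δ, hδ, A, hA, fun t m K Mh k R P' hN D hMh hP x₀ hx₀ Wd hWd hlev W hW S => ?_⟩
  classical
  refine h t (g := geomT D) (blkV1 hN D) S (fun b : PBond (PV d ℓ m K hd hL) 0 => (toBox hN b.src : Fin (d + 1) → ℤ)) (fun b => b.dir)
    x₀ hWd W hW (injOn_pos_dir_V1 hN W) (d + 1) (d + 1) (by positivity) (fun b hb b₁ hb₁ hbS hb₁S => ?_) ((ℓ + 1) ^ (d + 1))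
    (fun y _ => hfib_sites t D.toDomains (fun b : PBond (PV d ℓ m K hd hL) 0 => toBox hN b.src) (fun b => b.dir) x₀ hx₀ Wd hWd hlev W hW y)
  -- the distance input: `d_T ≤ d_box ≤ (d+1)(|·|_∞/L^j + 1)`
  have hbox := hglob_sites t D.toDomains hMh hP (fun b : PBond (PV d ℓ m K hd hL) 0 => toBox hN b.src) x₀ Wd
    (fun z hz hw => (hlev z hz hw).1) W hW Set.univ b hb b₁ hb₁ (Set.mem_univ _) (Set.mem_univ _)
  have hT : (((bondT D).dist (blkV1 hN D b) (blkV1 hN D b₁) : ℕ) : ℝ)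
      ≤ (((bond D.toDomains).dist (blkV1 hN D b) (blkV1 hN D b₁) : ℕ) : ℝ) := by
    exact_mod_cast distT_le_dist_box (D := D) hMh hP _ _
  exact hT.trans hbox

/-- the `∇_λG_□` twin on the V1 global torus. [cite: Balaban1984PropagatorsII, (2.133) p.247, Prop. 2.5 p.246] -/
theorem reach2133_DG_V1 (d ℓ : ℕ) (hd : 1 ≤ d + 1) (hL : Odd (ℓ + 1) ∧ 1 < ℓ + 1) {a₀ a₁ : ℝ} (ha₀ : 0 < a₀) (ha₁ : a₀ ≤ a₁) :
    ∃ δ : ℝ, 0 < δ ∧ ∃ A : ℝ, 0 ≤ A ∧ ∀ (t : TSIdx d (ℓ + 1) hd hL a₀ a₁) (lam : Fin t.P.d) (m K : ℕ) {Mh k R : ℕ} {P' : Fin (d + 1) → ℕ}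
      (hN : ∀ μ, N0 ℓ Mh k P' μ = (PV d ℓ m K hd hL).sitesPerDir 0) (D : B6MultiLevelTorusOperatorL0.TDomains d ℓ Mh k P' R) (_ : 1 ≤ Mh) (_ : ∀ μ, 1 ≤ P' μ)
      (x₀ : Fin (d + 1) → ℤ) (_ : ∀ μ, (((ℓ + 1) ^ t.j : ℕ) : ℤ) ∣ x₀ μ) (Wd : ℕ) (_ : Wd ≤ (ℓ + 1) ^ (t.m + t.K))
      (_ : ∀ z ∈ boxDom (N0 ℓ Mh k P'), (∀ μ, x₀ μ ≤ z μ ∧ z μ < x₀ μ + Wd) → t.j ≤ D.lev z ∧ D.lev z ≤ t.j + 1)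
      (W : Finset (PBond (PV d ℓ m K hd hL) 0))
      (_ : ∀ b ∈ W, InWindow (fun b : PBond (PV d ℓ m K hd hL) 0 => (toBox hN b.src : Fin (d + 1) → ℤ)) x₀ Wd b)
      (S : Set (geomT D).Site),
      LocalMajorant (g := geomT D) (blkV1 hN D)
        (transplant W (chartBond t (fun b : PBond (PV d ℓ m K hd hL) 0 => (toBox hN b.src : Fin (d + 1) → ℤ)) (fun b => b.dir) x₀)
          (onFun (t.Dl lam ∘ₗ t.D.G))) S
        (fun a b => ((ℓ + 1) ^ (d + 1) : ℕ) * ((A * Real.exp (δ * ((d + 1 : ℝ) + (d + 1)) / (d + 1))) *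
          Real.exp (-(δ / (d + 1) * (geomT D).dist a b)))) := by
  obtain ⟨δ, hδ, A, hA, h⟩ := reach2133_DG d (ℓ + 1) hd hL ha₀ ha₁
  refine ⟨δ, hδ, A, hA, fun t lam m K Mh k R P' hN D hMh hP x₀ hx₀ Wd hWd hlev W hW S => ?_⟩
  classical
  refine h t lam (g := geomT D) (blkV1 hN D) S (fun b : PBond (PV d ℓ m K hd hL) 0 => (toBox hN b.src : Fin (d + 1) → ℤ)) (fun b => b.dir)
    x₀ hWd W hW (injOn_pos_dir_V1 hN W) (d + 1) (d + 1) (by positivity) (fun b hb b₁ hb₁ hbS hb₁S => ?_) ((ℓ + 1) ^ (d + 1))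
    (fun y _ => hfib_sites t D.toDomains (fun b : PBond (PV d ℓ m K hd hL) 0 => toBox hN b.src) (fun b => b.dir) x₀ hx₀ Wd hWd hlev W hW y)
  have hbox := hglob_sites t D.toDomains hMh hP (fun b : PBond (PV d ℓ m K hd hL) 0 => toBox hN b.src) x₀ Wd
    (fun z hz hw => (hlev z hz hw).1) W hW Set.univ b hb b₁ hb₁ (Set.mem_univ _) (Set.mem_univ _)
  have hT : (((bondT D).dist (blkV1 hN D b) (blkV1 hN D b₁) : ℕ) : ℝ)
      ≤ (((bond D.toDomains).dist (blkV1 hN D b) (blkV1 hN D b₁) : ℕ) : ℝ) := by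
    exact_mod_cast distT_le_dist_box (D := D) hMh hP _ _
  exact hT.trans hbox

end H2133

/-! ## §3  The V1 nested family `Ω₀ = T ⊇ Ω₁ ⊇ … ⊇ Ω_k` (`B6SectADomainsV1.Domains`, the domain datum of `deltaAE`/`GE`) READ FROM p21's torus family
`TDomains` through the chart — so that the global `Δ_a` of ROUTE V is defined on a family satisfying (2.2) -/

section DomainsV1

open B6MultiLevelBoxOperator (bigSide)

variable {m K : ℕ} {hd : 1 ≤ d + 1} {hL : Odd (ℓ + 1) ∧ 1 < ℓ + 1}

open Classical in
/-- **THE V1 DOMAIN DATUM OF p21's TORUS FAMILY**: `Ω₀ := T_η` (V1's level `0` = the fine lattice; no `Λ₀`, as `Ω₁ = T_η` in p21's reading),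
`Ω_j^{(j)} := {y ∈ T^{(j)} : every fine site of B^j(y) has level ≥ j}` for `1 ≤ j ≤ k`, `∅` above `k` — the `B6SectADomainsV1.Domains` of the V1 global
torus on which `B6SectAVectorModelV1.deltaAE` (the multi-level `Δ_a` of (2.19)) is defined, now for a family satisfying (2.1) AND (2.2).
[cite: Balaban1984PropagatorsII, (2.1)–(2.4) p.224] -/
def domT {Mh k R : ℕ} {P' : Fin (d + 1) → ℕ} (hN : ∀ μ, N0 ℓ Mh k P' μ = (PV d ℓ m K hd hL).sitesPerDir 0) (D : TDomains d ℓ Mh k P' R)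
    (hk : k ≤ m + K) : B6SectADomainsV1.Domains (PV d ℓ m K hd hL) where
  k := k
  hk := hk
  Om j := if j = 0 then Finset.univ else if j ≤ k then
      Finset.univ.filter (fun y : Site (PV d ℓ m K hd hL) j => ∀ x : Site (PV d ℓ m K hd hL) 0, iterBlockOf j x = y → j ≤ D.lev (toBox hN x))
    else ∅
  Om_zero := by simp
  Om_eq_empty j hj := by
    have h1 : j ≠ 0 := by omega
    have h2 : ¬ j ≤ k := by omega
    simp [h1, h2]
  nested j y hy := by
    by_cases hj0 : j = 0
    · subst hj0; simp
    · have hj1 : j + 1 ≠ 0 := by omega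
      by_cases hjk : j + 1 ≤ k
      · simp only [hj1, if_false, hjk, if_true, Finset.mem_filter, Finset.mem_univ, true_and] at hy
        have hjk' : j ≤ k := by omega
        simp only [hj0, if_false, hjk', if_true, Finset.mem_filter, Finset.mem_univ, true_and]
        intro x hx
        have := hy x (by rw [B5Eq118OneStroke.iterBlockOf_succ, hx])
        omega
      · simp [hjk] at hy

/-- **THE DICTIONARY `Ω_j ↔ {lev ≥ j}`**: for `j ≤ k` (LEVEL-0 TWIN, JOINT J7: every order, the order `0` included), the block of order `j` of a fine site belongs to `Ω_j^{(j)}` of `domT` iff the site has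
level `≥ j` in p21's family — by (2.1) (membership in `Ω_j` is constant on big `j`-blocks, `TDomains.bigBlocks`, EVERY `j ≥ 1` in the level-0 structure).
[cite: Balaban1984PropagatorsII, (2.1)–(2.4) p.224] -/
theorem iterBlockOf_mem_domT_iff {Mh k R : ℕ} {P' : Fin (d + 1) → ℕ} (hN : ∀ μ, N0 ℓ Mh k P' μ = (PV d ℓ m K hd hL).sitesPerDir 0)
    (D : TDomains d ℓ Mh k P' R) (hk : k ≤ m + K) {j : ℕ} (hjk : j ≤ k) (x : Site (PV d ℓ m K hd hL) 0) :
    iterBlockOf j x ∈ (domT hN D hk).Om j ↔ j ≤ D.lev (toBox hN x) := by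
  classical
  -- LEVEL-0 TWIN (JOINT J7): no guard `1 ≤ j` — at the trivial order `j = 0` both sides hold (`Ω₀ = T_η`, `0 ≤ lev`)
  by_cases hj0 : j = 0
  · subst hj0
    simp [domT]
  have hj1 : 1 ≤ j := Nat.one_le_iff_ne_zero.2 hj0
  simp only [domT, hj0, if_false, hjk, if_true, Finset.mem_filter, Finset.mem_univ, true_and]
  constructor
  · intro h
    exact h x rfl
  · intro h x' hx'
    -- `x′` and `x` lie in the same `j`-block, hence in the same big `j`-block
    have hblk : blk ((ℓ + 1) ^ j) (toBox hN x' : Fin (d + 1) → ℤ) = blk ((ℓ + 1) ^ j) (toBox hN x : Fin (d + 1) → ℤ) := by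
      rw [blk_toBox hN (by omega) x', blk_toBox hN (by omega) x, hx']
    -- LEVEL-0 TWIN: (2.1) `bigBlocks` holds for EVERY `j ≥ 1` (a condition on `Ω₁` too), so no case split on `j = 1`
    have hbig := blk_bigSide_eq_of_blk_eq (Mh := Mh) hblk
    exact (D.bigBlocks j hj1 _ (toBox hN x).2 _ (toBox hN x').2 hbig).1 h

/- LEVEL-0 TWIN: the twin's `domT_Om_one` (`Ω₁ = T_η`) is NOT twinned — here `Ω₁ = {blocks all of whose sites have level ≥ 1}` may be a
proper subset of `T_η` (print's `Λ₀ = T ∖ Ω₁ ≠ ∅`); its two users (`B6ScalarChartV1`, `B6Ineq2142KLevelV1`) read `Ω₁` through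
`iterBlockOf_mem_domT_iff` (now guard-free: every `j ≤ k`, JOINT J7) in their L0 twins. -/

end DomainsV1

/-! ## §4  ROUTE V ASSEMBLED UP TO THE OPERATOR INPUTS: Proposition 2.6 (2.136)₁ on the V1 global torus with p21's geometry from (2.134) +
(2.91) ALONE — (2.133) (`reach2133_G_V1`) and Lemma 2.1 (`lemma21_torus`, K261) DISCHARGED in `B6Prop26ChainGeneric.prop26_2136_of_2133_2134With` -/

section Assembly

open B6Prop26Gluing (mulOp OutLoc)
open B6RandomWalk (delta3)
open B6Ineq261LevelGap (K261 K261_nonneg)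
open B6Geom246MultiLevelTorusL0 (lemma21_torus triangle_refl_nonneg_T)
open B6Prop26ChainGeneric (prop26_2136_of_2133_2134With)

variable {m K : ℕ} {hd : 1 ≤ d + 1} {hL : Odd (ℓ + 1) ∧ 1 < ℓ + 1} {a₀ a₁ : ℝ}

open Classical in
/-- **PROPOSITION 2.6, ENTRY (2.136)₁, ON THE V1 GLOBAL TORUS — THE GLUING WITH (2.133) AND LEMMA 2.1 DISCHARGED** (ROUTE V of B6-CLOSURE §5 item 7,
assembled up to the operator inputs (d3)/(d4)): there are `δ₂ > 0`, `A ≥ 0` (on `d, L, a₀, a₁`; from `reach2133_G_V1`) such that — for every V1 global torus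
with p21's torus family `D` (`hN`), every rate split `α ∈ [0, 1]` and Lemma-2.1 budget `N₀` with `N₀ + 1 ≤ R·M` and `e^{−α(δ₂′/2)}·L^{2(d+1)/N₀} < 1`
(`δ₂′ := 2δ₂/(d+1)`, the (2.59)-shape threshold of `lemma21_torus`), every cube family `𝒟` (index `C`) with reach sets `S_□ ⊂ 𝔅` of overlap `≤ N`, cut-offs
`h_□` (`|h_□| ≤ 1`, supported in the blocks of `S_□`), per-cube two-scale members `t_□` transplanted through two-level windows of the fundamental box
(`Gl □ := GlV1 (t □) hN (W □) (x₀ □)`), and every operator data `Kt`, `G`, `G₀`, `R`, `Δ_a` with (2.134) (`θ₀e^{−(δ₂′/2)d_T}` for all pairs, `hKout`), (2.91)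
(`Δ_aG₀ = 1 − R`, `R = Σ Kt·h`, `G₀ = Σ h_□·Gl □·h_□`), `GΔ_a = 1` and the located smallness `N²θ₀c₁ < 1` (`c₁ = K261 N₀ (d+1) L 1 (α·δ₂′/2)`) —
`G` has the majorant `(N·A′)·c₁·(1 − N²θ₀c₁)⁻¹·e^{−(1−α)(δ₂′/2)·d_T(y,y′)}`, `A′ = L^{d+1}·A·e^{2δ₂}`: (2.136)₁ for `x ∈ Δ(y)`, `supp J ⊂ Δ(y′)` on the lattice of
`B6SectAVectorModelV1.deltaAE`/`GE`.  What remains hypothesis is EXACTLY (d3) (the (2.91) algebra `h291`/`hR`/`hG0` for the genuine `Δ_a = deltaAE` and the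
transplanted members) and (d4) (`h2134` for the genuine `Kt`), plus the cover data. [cite: Balaban1984PropagatorsII, Prop. 2.6 (2.136) p.247, (2.133)–(2.135) p.247, (2.91) p.239, Lemma 2.1 p.234] -/
theorem prop26_2136_V1_of_2134_291 (d ℓ : ℕ) (hd : 1 ≤ d + 1) (hL : Odd (ℓ + 1) ∧ 1 < ℓ + 1) {a₀ a₁ : ℝ} (ha₀ : 0 < a₀) (ha₁ : a₀ ≤ a₁) :
    ∃ δ : ℝ, 0 < δ ∧ ∃ A : ℝ, 0 ≤ A ∧ ∀ (m K : ℕ) {Mh k R : ℕ} {P' : Fin (d + 1) → ℕ}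
      (hN : ∀ μ, N0 ℓ Mh k P' μ = (PV d ℓ m K hd hL).sitesPerDir 0) (D : TDomains d ℓ Mh k P' R) (hMh : 1 ≤ Mh) (hP : ∀ μ, 1 ≤ P' μ)
      -- Lemma 2.1 budget on the torus (the (2.59)-shape threshold of `lemma21_torus` at rate α·δ/(d+1))
      (α : ℝ) (_ : 0 ≤ α) (_ : α ≤ 1) (N₀ : ℕ) (_ : 0 < N₀) (_ : N₀ + 1 ≤ R * ((ℓ + 1) * Mh))
      (_ : Real.exp (-(α * (δ / (d + 1)))) * ((ℓ : ℝ) + 1) ^ ((2 * (d + 1 : ℕ) : ℝ) / N₀) < 1)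
      -- the cube family, its reaches, overlap and cut-offs
      {C : Type} (Dc : Finset C) (S : C → Set (geomT D).Site) (N : ℕ)
      (_ : ∀ a : (geomT D).Site, (Dc.filter fun c => a ∈ S c).card ≤ N)
      (h : C → PBond (PV d ℓ m K hd hL) 0 → ℝ) (_ : ∀ c ∈ Dc, ∀ b, h c b ≠ 0 → blkV1 hN D b ∈ S c) (_ : ∀ c ∈ Dc, ∀ b, |h c b| ≤ 1)
      -- per-cube two-scale members through two-level windows of the fundamental box
      (t : C → TSIdx d (ℓ + 1) hd hL a₀ a₁) (x₀ : C → Fin (d + 1) → ℤ) (Wd : C → ℕ) (W : C → Finset (PBond (PV d ℓ m K hd hL) 0))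
      (_ : ∀ c ∈ Dc, ∀ μ, (((ℓ + 1) ^ (t c).j : ℕ) : ℤ) ∣ x₀ c μ) (_ : ∀ c ∈ Dc, Wd c ≤ (ℓ + 1) ^ ((t c).m + (t c).K))
      (_ : ∀ c ∈ Dc, ∀ z ∈ boxDom (N0 ℓ Mh k P'), (∀ μ, x₀ c μ ≤ z μ ∧ z μ < x₀ c μ + Wd c) → (t c).j ≤ D.lev z ∧ D.lev z ≤ (t c).j + 1)
      (_ : ∀ c ∈ Dc, ∀ b ∈ W c, InWindow (fun b : PBond (PV d ℓ m K hd hL) 0 => (toBox hN b.src : Fin (d + 1) → ℤ)) (x₀ c) (Wd c) b)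
      -- the operator inputs: (2.134) for the genuine kernels, (2.91), `GΔ_a = 1`, and the located smallness
      (θ₀ : ℝ) (_ : 0 ≤ θ₀) (Kt : C → C → Module.End ℝ (PBond (PV d ℓ m K hd hL) 0 → ℝ))
      (_ : ∀ c ∈ Dc, ∀ c' ∈ Dc, HasMajorant (g := geomT D) (blkV1 hN D) (Kt c c' * mulOp (h c'))
        (fun a b => θ₀ * Real.exp (-((2 * (δ / (d + 1))) / 2 * (geomT D).dist a b))))
      (_ : ∀ c ∈ Dc, ∀ c' ∈ Dc, OutLoc (g := geomT D) (blkV1 hN D) (Kt c c') (S c))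
      {G G0 Rr Δa : Module.End ℝ (PBond (PV d ℓ m K hd hL) 0 → ℝ)}
      (_ : G0 = ∑ c ∈ Dc, mulOp (h c) * GlV1 (t c) hN (W c) (x₀ c) * mulOp (h c))
      (_ : Rr = ∑ c ∈ Dc, ∑ c' ∈ Dc, Kt c c' * mulOp (h c')) (_ : G * Δa = 1) (_ : Δa * G0 = 1 - Rr)
      (_ : (N : ℝ) ^ 2 * θ₀ * K261 N₀ (d + 1) ((ℓ : ℝ) + 1) 1 (α * (δ / (d + 1))) < 1),
      HasMajorant (g := geomT D) (blkV1 hN D) G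
        (fun a b => (N * (((ℓ + 1) ^ (d + 1) : ℕ) * (A * Real.exp (δ * ((d + 1 : ℝ) + (d + 1)) / (d + 1))))) *
          K261 N₀ (d + 1) ((ℓ : ℝ) + 1) 1 (α * (δ / (d + 1))) *
          (1 - (N : ℝ) ^ 2 * θ₀ * K261 N₀ (d + 1) ((ℓ : ℝ) + 1) 1 (α * (δ / (d + 1))))⁻¹ * 1 *
          Real.exp (-(delta3 α (2 * (δ / (d + 1))) * (geomT D).dist a b))) := by
  obtain ⟨δ, hδ, A, hA, h2133⟩ := reach2133_G_V1 d ℓ hd hL ha₀ ha₁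
  refine ⟨δ, hδ, A, hA, fun m K Mh k R P' hN D hMh hP α hα0 hα1 N₀ hN₀ hRM hθ C Dc S N hNov h hsupp hle t x₀ Wd W hx₀ hWd hlev hW
    θ₀ hθ₀ Kt h2134 hKout G G0 Rr Δa hG0 hR hinv h291 hsmall => ?_⟩
  classical
  -- Lemma 2.1 on the torus at rate δ₀ := δ₂′/2 = δ/(d+1) with the split α
  have hδ0 : (0 : ℝ) ≤ δ / (d + 1) := by positivity
  obtain ⟨_, h261, _, h263⟩ := lemma21_torus D hMh hP hN₀ hRM hδ0 hα0 hα1 hθ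
  obtain ⟨htri, hrefl, hdnn⟩ := triangle_refl_nonneg_T D hMh hP
  have hc : 0 ≤ K261 N₀ (d + 1) ((ℓ : ℝ) + 1) 1 (α * (δ / (d + 1))) := K261_nonneg (by positivity) zero_le_one
  have hδ2 : (0 : ℝ) ≤ 2 * (δ / (d + 1)) := by positivity
  have hhalf : 2 * (δ / (d + 1)) / 2 = δ / (d + 1) := by ring
  -- the (2.133) input per cube, read with the weight `P ≡ 1`
  have hA' : 0 ≤ (((ℓ + 1) ^ (d + 1) : ℕ) : ℝ) * (A * Real.exp (δ * ((d + 1 : ℝ) + (d + 1)) / (d + 1))) := by positivity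
  have h2133' : ∀ c ∈ Dc, B6Prop26Gluing.LocalMajorant (g := geomT D) (blkV1 hN D) (GlV1 (t c) hN (W c) (x₀ c)) (S c)
      (fun a b => (((ℓ + 1) ^ (d + 1) : ℕ) : ℝ) * (A * Real.exp (δ * ((d + 1 : ℝ) + (d + 1)) / (d + 1))) * (fun _ => (1 : ℝ)) a *
        Real.exp (-(2 * (δ / (d + 1)) / 2 * (geomT D).dist a b))) := by
    intro c hc'
    have hK : (fun a b : (geomT D).Site => (((ℓ + 1) ^ (d + 1) : ℕ) : ℝ) * (A * Real.exp (δ * ((d + 1 : ℝ) + (d + 1)) / (d + 1))) *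
        (fun _ => (1 : ℝ)) a * Real.exp (-(2 * (δ / (d + 1)) / 2 * (geomT D).dist a b))) =
        (fun a b => (((ℓ + 1) ^ (d + 1) : ℕ) : ℝ) * ((A * Real.exp (δ * ((d + 1 : ℝ) + (d + 1)) / (d + 1))) *
          Real.exp (-(δ / (d + 1) * (geomT D).dist a b)))) := by
      funext a b
      rw [hhalf]
      ring
    rw [hK]
    exact h2133 (t c) m K hN D hMh hP (x₀ c) (hx₀ c hc') (Wd c) (hWd c hc') (hlev c hc') (W c) (hW c hc') (S c)
  have hmain := prop26_2136_of_2133_2134With (g := geomT D) (blkV1 hN D) (K261 N₀ (d + 1) ((ℓ : ℝ) + 1) 1 (α * (δ / (d + 1))))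
    (2 * (δ / (d + 1))) α θ₀ ((((ℓ + 1) ^ (d + 1) : ℕ) : ℝ) * (A * Real.exp (δ * ((d + 1 : ℝ) + (d + 1)) / (d + 1))))
    (fun _ => (1 : ℝ)) hc hA' (fun _ => zero_le_one) hθ₀ hα1 hδ2 htri hrefl hdnn (by rw [hhalf]; exact h261) (by rw [hhalf]; exact h263)
    Dc S N hNov hsmall h hsupp hle (fun c => GlV1 (t c) hN (W c) (x₀ c)) h2133' Kt h2134 hKout hG0 hR hinv h291
  simpa only [hhalf] using hmain

end Assembly

/-! ## §5  (v1.1) ROUTE V WITH (2.91) AS RING HYPOTHESES: (2.136)₁ on the V1 global torus from (2.134) for the (2.92)/(2.93) kernel family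
`K_{□,□′} := kFam` + the five ring hypotheses of `B6Eq291Generator.eq291` (Σh² = 1, `Mh_□ = M_□h_□`, `(M_□ − P_□)G_□h_□ = h_□`, `ζ_□h_□ = h_□ = h_□ζ_□`)
— (2.91) itself DISCHARGED by `eq291`, `|h_□| ≤ 1` by (2.36) -/

section AssemblyEq291

open B6Prop26Gluing (mulOp mulOp_apply OutLoc abs_le_one_of_sum_sq)
open B6RandomWalk (delta3)
open B6Ineq261LevelGap (K261)
open B6Eq291Generator (kFam gZero rOp eq291)

variable {X : Type}

/-- `h₁·(h₂·v) = (h₁h₂)·v`. [folklore] -/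
private theorem mulOp_mul_mulOp (f h : X → ℝ) : mulOp f * mulOp h = mulOp (fun x => f x * h x) := by
  apply LinearMap.ext; intro v; funext x
  simp only [Module.End.mul_apply, mulOp_apply, mul_assoc]

/-- `Σ_□ h_□² = 1` pointwise ⟹ `Σ_□ h_□·h_□ = 1` as operators. [folklore] -/
private theorem sum_mulOp_sq_eq_one {C : Type} (Dc : Finset C) (h : C → X → ℝ) (hpart : ∀ x, ∑ c ∈ Dc, h c x ^ 2 = 1) :
    ∑ c ∈ Dc, mulOp (h c) * mulOp (h c) = 1 := by
  apply LinearMap.ext; intro v; funext x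
  simp only [mulOp_mul_mulOp, LinearMap.coe_sum, Finset.sum_apply, mulOp_apply, Module.End.one_apply]
  rw [← Finset.sum_mul]
  have : ∑ c ∈ Dc, h c x * h c x = 1 := by simpa only [sq] using hpart x
  rw [this, one_mul]

open Classical in
/-- **PROPOSITION 2.6, ENTRY (2.136)₁, ON THE V1 GLOBAL TORUS FROM (2.134) AND THE RING HYPOTHESES OF (2.91)** (v1.1; ROUTE V assembled one step
further than `prop26_2136_V1_of_2134_291`): with the same `δ₂, A` — for every V1 global torus with p21's torus family `D` (`hN`), Lemma-2.1 budget
(`α`, `N₀`, the (2.59)-shape threshold), cube family `𝒟` with reaches `S_□` of overlap `≤ N`, a QUADRATIC PARTITION OF UNITY `Σ_□ h_□² = 1` ((2.36);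
`|h_□| ≤ 1` follows, `abs_le_one_of_sum_sq`) supported blockwise in `S_□`, cut-offs `ζ_□` with `ζ_□h_□ = h_□ = h_□ζ_□`, per-cube transplanted two-scale
members `G_□ := GlV1 (t □) hN (W □) (x₀ □)` through two-level windows, local operators `M_□` AGREEING WITH THE LOCAL PART `M` OF `Δ_a = M − ∂P∂*` ON
`h_□` (`Mh_□ = M_□h_□`) and inverted by the members on `h_□` (`(M_□ − P_□)G_□h_□ = h_□`), GIVEN (2.134) for the genuine (2.92)/(2.93) family
`K_{□,□′}G_{□′}h_{□′}` (`K := B6Eq291Generator.kFam (∂P∂*) h ζ M P`, majorant `θ₀e^{−(δ₂′/2)d_T}`, `hKout`), `GΔ_a = 1` and `N²θ₀c₁ < 1`: `G` has the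
majorant `(N·A′)·c₁·(1 − N²θ₀c₁)⁻¹·e^{−(1−α)(δ₂′/2)d_T}` — (2.136)₁.  (2.91) `Δ_aG₀ = 1 − R` is DISCHARGED here by `B6Eq291Generator.eq291`; what remains
hypothesis is (d3) proper (`hagree`, `hinv` for `deltaAE` vs. the transplanted `tsV1` members, `hzh`/`hhz`, (2.36)) and (d4) (`h2134`, `hKout`).
[cite: Balaban1984PropagatorsII, Prop. 2.6 (2.136) p.247, (2.91)–(2.93) p.239, (2.134) p.247, (2.36) p.229, Lemma 2.1 p.234] -/
theorem prop26_2136_V1_of_2134_eq291 (d ℓ : ℕ) (hd : 1 ≤ d + 1) (hL : Odd (ℓ + 1) ∧ 1 < ℓ + 1) {a₀ a₁ : ℝ} (ha₀ : 0 < a₀) (ha₁ : a₀ ≤ a₁) :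
    ∃ δ : ℝ, 0 < δ ∧ ∃ A : ℝ, 0 ≤ A ∧ ∀ (m K : ℕ) {Mh k R : ℕ} {P' : Fin (d + 1) → ℕ}
      (hN : ∀ μ, N0 ℓ Mh k P' μ = (PV d ℓ m K hd hL).sitesPerDir 0) (D : TDomains d ℓ Mh k P' R) (_ : 1 ≤ Mh) (_ : ∀ μ, 1 ≤ P' μ)
      (α : ℝ) (_ : 0 ≤ α) (_ : α ≤ 1) (N₀ : ℕ) (_ : 0 < N₀) (_ : N₀ + 1 ≤ R * ((ℓ + 1) * Mh))
      (_ : Real.exp (-(α * (δ / (d + 1)))) * ((ℓ : ℝ) + 1) ^ ((2 * (d + 1 : ℕ) : ℝ) / N₀) < 1)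
      {C : Type} (Dc : Finset C) (S : C → Set (geomT D).Site) (N : ℕ)
      (_ : ∀ a : (geomT D).Site, (Dc.filter fun c => a ∈ S c).card ≤ N)
      -- the quadratic partition of unity (2.36) and the cut-offs ζ_□
      (h ζ : C → PBond (PV d ℓ m K hd hL) 0 → ℝ) (_ : ∀ b, ∑ c ∈ Dc, h c b ^ 2 = 1) (_ : ∀ c ∈ Dc, ∀ b, h c b ≠ 0 → blkV1 hN D b ∈ S c)
      (_ : ∀ c ∈ Dc, mulOp (ζ c) * mulOp (h c) = mulOp (h c)) (_ : ∀ c ∈ Dc, mulOp (h c) * mulOp (ζ c) = mulOp (h c))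
      -- per-cube two-scale members through two-level windows of the fundamental box
      (t : C → TSIdx d (ℓ + 1) hd hL a₀ a₁) (x₀ : C → Fin (d + 1) → ℤ) (Wd : C → ℕ) (W : C → Finset (PBond (PV d ℓ m K hd hL) 0))
      (_ : ∀ c ∈ Dc, ∀ μ, (((ℓ + 1) ^ (t c).j : ℕ) : ℤ) ∣ x₀ c μ) (_ : ∀ c ∈ Dc, Wd c ≤ (ℓ + 1) ^ ((t c).m + (t c).K))
      (_ : ∀ c ∈ Dc, ∀ z ∈ boxDom (N0 ℓ Mh k P'), (∀ μ, x₀ c μ ≤ z μ ∧ z μ < x₀ c μ + Wd c) → (t c).j ≤ D.lev z ∧ D.lev z ≤ (t c).j + 1)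
      (_ : ∀ c ∈ Dc, ∀ b ∈ W c, InWindow (fun b : PBond (PV d ℓ m K hd hL) 0 => (toBox hN b.src : Fin (d + 1) → ℤ)) (x₀ c) (Wd c) b)
      -- the splitting Δ_a = M − ∂P∂*, the local operators M_□ and projections P_□ of the members, agreement and inversion on h_□
      {Δa M Dg : Module.End ℝ (PBond (PV d ℓ m K hd hL) 0 → ℝ)} (_ : Δa = M - Dg)
      (Ml Pl : C → Module.End ℝ (PBond (PV d ℓ m K hd hL) 0 → ℝ))
      (_ : ∀ c ∈ Dc, M * mulOp (h c) = Ml c * mulOp (h c))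
      (_ : ∀ c ∈ Dc, (Ml c - Pl c) * GlV1 (t c) hN (W c) (x₀ c) * mulOp (h c) = mulOp (h c))
      -- (2.134) for the genuine (2.92)/(2.93) family, its output localisation, `GΔ_a = 1`, and the located smallness
      (θ₀ : ℝ) (_ : 0 ≤ θ₀)
      (_ : ∀ c ∈ Dc, ∀ c' ∈ Dc, HasMajorant (g := geomT D) (blkV1 hN D)
        ((kFam Dg (fun c => mulOp (h c)) (fun c => mulOp (ζ c)) Ml Pl c c' * GlV1 (t c') hN (W c') (x₀ c')) * mulOp (h c'))
        (fun a b => θ₀ * Real.exp (-((2 * (δ / (d + 1))) / 2 * (geomT D).dist a b))))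
      (_ : ∀ c ∈ Dc, ∀ c' ∈ Dc, OutLoc (g := geomT D) (blkV1 hN D)
        (kFam Dg (fun c => mulOp (h c)) (fun c => mulOp (ζ c)) Ml Pl c c' * GlV1 (t c') hN (W c') (x₀ c')) (S c))
      {G : Module.End ℝ (PBond (PV d ℓ m K hd hL) 0 → ℝ)} (_ : G * Δa = 1)
      (_ : (N : ℝ) ^ 2 * θ₀ * K261 N₀ (d + 1) ((ℓ : ℝ) + 1) 1 (α * (δ / (d + 1))) < 1),
      HasMajorant (g := geomT D) (blkV1 hN D) G
        (fun a b => (N * (((ℓ + 1) ^ (d + 1) : ℕ) * (A * Real.exp (δ * ((d + 1 : ℝ) + (d + 1)) / (d + 1))))) *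
          K261 N₀ (d + 1) ((ℓ : ℝ) + 1) 1 (α * (δ / (d + 1))) *
          (1 - (N : ℝ) ^ 2 * θ₀ * K261 N₀ (d + 1) ((ℓ : ℝ) + 1) 1 (α * (δ / (d + 1))))⁻¹ * 1 *
          Real.exp (-(delta3 α (2 * (δ / (d + 1))) * (geomT D).dist a b))) := by
  obtain ⟨δ, hδ, A, hA, h⟩ := prop26_2136_V1_of_2134_291 d ℓ hd hL ha₀ ha₁
  refine ⟨δ, hδ, A, hA, fun m K Mh k R P' hN D hMh hP α hα0 hα1 N₀ hN₀ hRM hθ C Dc S N hNov hh ζ hpart hsupp hzh hhz t x₀ Wd W hx₀ hWd hlev hW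
    Δa M Dg hΔ Ml Pl hagree hinvl θ₀ hθ₀ h2134 hKout G hinv hsmall => ?_⟩
  classical
  have hle : ∀ c ∈ Dc, ∀ b, |hh c b| ≤ 1 := fun c hc b => abs_le_one_of_sum_sq Dc hh b (hpart b) c hc
  -- (2.91) from the ring identity `eq291` with H := h_□·, Z := ζ_□·, g := the transplanted members
  have h291 : Δa * gZero Dc (fun c => mulOp (hh c)) (fun c => GlV1 (t c) hN (W c) (x₀ c)) =
      1 - rOp Dc Dg (fun c => mulOp (hh c)) (fun c => mulOp (ζ c)) (fun c => GlV1 (t c) hN (W c) (x₀ c)) Ml Pl := by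
    rw [hΔ]
    exact eq291 Dc M Dg (fun c => mulOp (hh c)) (fun c => mulOp (ζ c)) (fun c => GlV1 (t c) hN (W c) (x₀ c)) Ml Pl
      (sum_mulOp_sq_eq_one Dc hh hpart) hagree hinvl hzh hhz
  exact h m K hN D hMh hP α hα0 hα1 N₀ hN₀ hRM hθ Dc S N hNov hh hsupp hle t x₀ Wd W hx₀ hWd hlev hW θ₀ hθ₀
    (fun c c' => kFam Dg (fun c => mulOp (hh c)) (fun c => mulOp (ζ c)) Ml Pl c c' * GlV1 (t c') hN (W c') (x₀ c')) h2134 hKout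
    (G0 := gZero Dc (fun c => mulOp (hh c)) (fun c => GlV1 (t c) hN (W c) (x₀ c)))
    (Rr := rOp Dc Dg (fun c => mulOp (hh c)) (fun c => mulOp (ζ c)) (fun c => GlV1 (t c) hN (W c) (x₀ c)) Ml Pl)
    rfl rfl hinv h291 hsmall

end AssemblyEq291

end Literature.MathematicalPhysics.QuantumFieldTheory.Balaban1983to89.B6GlobalChartV1L0
end
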